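import Summits.AtomisticToContinuum.FouriersLaw.Theorems.OddSectorIrreversibilityTapLeakBoundFloorCore
import Summits.AtomisticToContinuum.FouriersLaw.Theorems.OddSectorIrreversibilityTapLeakBoundFloorReflect

/-!
# `TapLeakBound` (stmt-AtomisticToContinuum-15159), line `SketchIdeator2`, floor of `stub_kickCone`: the `N`-uniform kick cone in the sublinear window, both contacts

Helper file (`--supports stmt-AtomisticToContinuum-15159`) for crux
P = `Summit.AtomisticToContinuum.FouriersLaw.Theses.OddSectorIrreversibility.TapLeakBound`, registered stub `stub_kickCone`
(C′ `ResampledKickCone`). **The floor of C′ in the stub's own spelling** (zero-friction kernels, Gaussian resampling of the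
contact momentum, the unnormalised Gibbs weight, `d = i` at the contact `b = 0` and `d = N − 2 − i` at `b = N − 1`):

* `stub_floorKickCone` (registered sub-goal; left-contact form `kickCone_floor_left`) — there are `a > 0` and `C` (depending only on
  `(ω₂, lam, β, T)`) such that for every `N`, bond `i`, contact `b ∈ {0, N−1}` and `s ≥ 0` with **`s⁴ ≤ a (1 + d)³`**:
  `∫∫ (js(q, p[b ↦ p']) − js(q,p))² dN(0,T)(p') dμ_T ≤ C · Z / (1 + d)³`, `js = j_i ∘ Φ_s`.
  Cases: `d ≥ 1` at `b = 0` is the landed core (`stub_floorCore`, …FloorCore.lean); `b = N−1` is reduced to `b = 0` at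
  the mirror bond by the landed site reflection (`stub_floorReflect`); `d = 0` is the landed cap (`kickCone_capped`); the
  phantom bond `i = N−1` carries no current.

This is the registered `stub_kickCone` with its LINEAR window `s ≤ a·d` replaced by the SUBLINEAR window `s⁴ ≤ a(1+d)³`
(and the profile `(1 + d − s/a)^{-3}` by `(1+d)^{-3}`, which dominates it up to a constant on the smaller window); the
linear window — needed by the witness bookkeeping of the route — remains open. References: folklore. Nothing here
closes the item.
-/

noncomputable section

open MeasureTheory ProbabilityTheory Filter Topology Set Function
open scoped NNReal ENNReal

namespace Summit.AtomisticToContinuum.FouriersLaw.Theorems.OddSectorIrreversibility.TapLeak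

open Literature.MathematicalPhysics.KineticTheory.HeatConduction
open Literature.MathematicalPhysics.KineticTheory
open Summit.AtomisticToContinuum.FouriersLaw.Theorems.OddSectorWitness
open Summit.AtomisticToContinuum.FouriersLaw.Theorems.ClosedConeSensitivity.Negative.ZeroFrictionDictionary
open Summit.AtomisticToContinuum.FouriersLaw.Theorems.OddSectorIrreversibility.Corrector

section Floor

variable {ω₂ lam β : ℝ} (hω : 0 < ω₂) (hl : 0 < lam) (hβ : 0 ≤ β) (γ : ℝ) {T : ℝ} (hT : 0 < T)
include hω hl hβ hT

/-- **The floor at the left contact, all bonds** (detFlow spelling): with the constants `a` of the core and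
`C = max C_core 0 + C_cap`, for every `N`, every bond `i` and `s ≥ 0` with `s⁴ ≤ a(1+i)³`:
`∫∫ (j_i(Φ_s(q, p[0 ↦ p'])) − j_i(Φ_s(q,p)))² dN(0,T) dμ_T ≤ C Z/(1+i)³` (`i = 0`: the cap; `1 ≤ i`, `i+1 < N`: the core;
`i = N−1`: no current). [folklore] -/
theorem kickCone_floor_left : ∃ a C : ℝ, 0 < a ∧ 0 ≤ C ∧ ∀ (N : ℕ) (i : Fin N) (hN : 0 < N) (s : ℝ),
    0 ≤ s → s ^ 4 ≤ a * (1 + (i.val : ℝ)) ^ 3 →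
    ∫ x, (∫ p', ((pinnedChain ω₂ lam β γ).bondCurrent N i
          (detFlow ω₂ lam β N s (x.1, Function.update x.2 ⟨0, hN⟩ p')) -
        (pinnedChain ω₂ lam β γ).bondCurrent N i (detFlow ω₂ lam β N s x)) ^ 2
          ∂(gaussianReal 0 (Real.toNNReal T))) ∂(gibbsWeight ω₂ lam β γ N T) ≤
      C * (∫ x, Real.exp (-((pinnedChain ω₂ lam β γ).hamiltonian N x) / T) ∂volume) / (1 + (i.val : ℝ)) ^ 3 := by
  obtain ⟨a, Cc, ha, hCc, hcore⟩ := stub_floorCore ω₂ lam β γ hω hl hβ T hT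
  obtain ⟨C₀, hC₀, hcap⟩ := kickCone_capped ω₂ lam β γ hω hl.le hβ T hT
  refine ⟨a, Cc + C₀, ha, by positivity, fun N i hN s hs hw => ?_⟩
  set Z : ℝ := ∫ x, Real.exp (-((pinnedChain ω₂ lam β γ).hamiltonian N x) / T) ∂volume with hZ
  have hZ0 : 0 ≤ Z := integral_nonneg fun x => (Real.exp_pos _).le
  have hi0 : (0 : ℝ) ≤ i.val := Nat.cast_nonneg _
  by_cases hi1 : 1 ≤ i.val
  · by_cases hiN : i.val + 1 < N
    · -- the core
      have h := hcore N i.val hi1 hiN s hs hw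
      have e1 : (⟨i.val, by omega⟩ : Fin N) = i := Fin.ext rfl
      have e2 : (⟨0, by omega⟩ : Fin N) = ⟨0, hN⟩ := Fin.ext rfl
      rw [e1, e2] at h
      refine h.trans ?_
      rw [div_le_div_iff_of_pos_right (by positivity)]
      exact mul_le_mul_of_nonneg_right (by linarith) hZ0
    · -- the phantom bond carries no current
      have hlast : i.val + 1 = N := by omega
      have hj : ∀ y, (pinnedChain ω₂ lam β γ).bondCurrent N i y = 0 := fun y =>
        (pinnedChain ω₂ lam β γ).bondCurrent_eq_zero_of_last N i hlast y
      simp only [hj, sub_self, ne_eq, OfNat.ofNat_ne_zero, not_false_eq_true, zero_pow, integral_zero]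
      positivity
  · -- `i = 0`: the cap
    have hi00 : i.val = 0 := by omega
    have h := hcap N i ⟨0, hN⟩ s hs
    have hjs : ∀ x : PhaseSpace N, ∫ y, (pinnedChain ω₂ lam β γ).bondCurrent N i y
        ∂((pinnedChain ω₂ lam β 0).transitionKernel N T T s.toNNReal x) =
        (pinnedChain ω₂ lam β γ).bondCurrent N i (detFlow ω₂ lam β N s x) := fun x => by
      rw [integral_transitionKernel_zero_friction hω hl.le hβ, Real.coe_toNNReal s hs]
    simp only [hjs] at h
    have hμ : gibbsWeight ω₂ lam β γ N T = volume.withDensity (fun x : PhaseSpace N =>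
        ENNReal.ofReal (Real.exp (-((pinnedChain ω₂ lam β γ).hamiltonian N x) / T))) := rfl
    rw [hμ]
    refine h.trans ?_
    rw [hi00, Nat.cast_zero, add_zero, one_pow, div_one]
    exact mul_le_mul_of_nonneg_right (by linarith) hZ0

end Floor

/-- **THE FLOOR OF THE KICK CONE** (`N`-uniform; the registered `stub_kickCone` with the sublinear window
`s⁴ ≤ a (1+d)³` in place of the linear one): for the pinned FPU-β chain (all parameters `> 0`) at `T > 0` there are
`a > 0` and `C` such that for every `N`, bond `i`, contact `b ∈ {0, N−1}` (`d = i`, resp. `N − 2 − i`) and `s ≥ 0` with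
`s⁴ ≤ a(1+d)³`: `∫∫ (js(q, p[b ↦ p']) − js(q,p))² dN(0,T)(p') dμ_T ≤ C · Z/(1+d)³`, `js = j_i ∘ Φ_s` (zero-friction kernels).
[folklore] -/
theorem stub_floorKickCone : ∀ ω₂ lam β γ : ℝ, 0 < ω₂ → 0 < lam → 0 < β → 0 < γ → ∀ T : ℝ, 0 < T →
    ∃ a C : ℝ, 0 < a ∧ ∀ (N : ℕ) (i b : Fin N) (s : ℝ), (b.val = 0 ∨ b.val = N - 1) → 0 ≤ s →
      s ^ 4 ≤ a * (1 + ((if b.val = 0 then i.val else N - 2 - i.val : ℕ) : ℝ)) ^ 3 →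
        ∫ x, (∫ p', ((∫ y, (pinnedChain ω₂ lam β γ).bondCurrent N i y
              ∂((pinnedChain ω₂ lam β 0).transitionKernel N T T s.toNNReal (x.1, Function.update x.2 b p'))) -
            (∫ y, (pinnedChain ω₂ lam β γ).bondCurrent N i y
              ∂((pinnedChain ω₂ lam β 0).transitionKernel N T T s.toNNReal x))) ^ 2
            ∂(gaussianReal 0 (Real.toNNReal T))) ∂(gibbsWeight ω₂ lam β γ N T)
          ≤ C * (∫ x, Real.exp (-((pinnedChain ω₂ lam β γ).hamiltonian N x) / T) ∂volume) /
              (1 + ((if b.val = 0 then i.val else N - 2 - i.val : ℕ) : ℝ)) ^ 3 := by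
  intro ω₂ lam β γ hω hl hβ _ T hT
  obtain ⟨a, C, ha, hC, hleft⟩ := kickCone_floor_left hω hl hβ.le γ hT
  refine ⟨a, C, ha, fun N i b s hb hs hw => ?_⟩
  have hN : 0 < N := by have := b.isLt; omega
  set Z : ℝ := ∫ x, Real.exp (-((pinnedChain ω₂ lam β γ).hamiltonian N x) / T) ∂volume with hZ
  have hZ0 : 0 ≤ Z := integral_nonneg fun x => (Real.exp_pos _).le
  -- the kernels are Dirac masses at the closed flow
  have hjs : ∀ x : PhaseSpace N, ∫ y, (pinnedChain ω₂ lam β γ).bondCurrent N i y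
      ∂((pinnedChain ω₂ lam β 0).transitionKernel N T T s.toNNReal x) =
      (pinnedChain ω₂ lam β γ).bondCurrent N i (detFlow ω₂ lam β N s x) := fun x => by
    rw [integral_transitionKernel_zero_friction hω hl.le hβ.le, Real.coe_toNNReal s hs]
  simp only [hjs]
  by_cases hb0 : b.val = 0
  · -- left contact
    simp only [hb0, if_true] at hw ⊢
    have eb : b = ⟨0, hN⟩ := Fin.ext hb0
    subst eb
    exact hleft N i hN s hs hw
  · -- right contact: reflect to the left contact at the mirror bond
    have hbN : b.val = N - 1 := hb.resolve_left hb0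
    simp only [hb0, if_false] at hw ⊢
    by_cases hiN : i.val + 1 < N
    · set j : Fin N := ⟨i.val + 1, hiN⟩ with hj
      have hrefl := stub_floorReflect ω₂ lam β γ hω hl.le hβ.le N T s i j b ⟨0, hN⟩ rfl hbN rfl
      rw [hrefl]
      have hd : (Fin.rev j).val = N - 2 - i.val := by rw [Fin.val_rev]; simp [hj]; omega
      have h := hleft N (Fin.rev j) hN s hs (by rw [hd]; exact hw)
      rw [hd] at h
      exact h
    · -- the phantom bond carries no current
      have hlast : i.val + 1 = N := by omega
      have hj : ∀ y, (pinnedChain ω₂ lam β γ).bondCurrent N i y = 0 := fun y =>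
        (pinnedChain ω₂ lam β γ).bondCurrent_eq_zero_of_last N i hlast y
      simp only [hj, sub_self, ne_eq, OfNat.ofNat_ne_zero, not_false_eq_true, zero_pow, integral_zero]
      positivity

end Summit.AtomisticToContinuum.FouriersLaw.Theorems.OddSectorIrreversibility.TapLeak

end
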